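import Summits.KontsevichZagierPeriods.KontsevichZagierPeriods.Theorems.OctahedralSymmetryOctahedralSpanAllWeightsStubRegularE0DepthThreeBinaryCore
import HarnessLib

/-!
# Crux `OctahedralSpanAllWeights` (stmt-KontsevichZagierPeriods-9659), line `Sketch`, block F1:
# binary INTERIOR words of every depth reduce by ONE finite double shuffle (all weights)

**Theorem `binaryInterior` (all weights, all depths).** Let `k = ((s₁,e₁),…,(s_d,e_d))` be a level-4
index with every part `sⱼ ≥ 2` and all cumulative poles in `{i, −i}` (cumulative exponent sums odd).
Its word `word k = 4^{s₁−1} c₁ ⋯ 4^{s_d−1} c_d` (letters `cⱼ ∈ {1, 3}`, every block of `4` nonempty: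
an INTERIOR point of the exponent simplex) lies, modulo `rel`, in `RegularE0.e0Lower (word k)` —
the span of the `e₁`-free convergent words of the same length with fewer letters `4` (the target of
block F1 of line `Sketch`).  In value terms: every `Li_{s₁,…,s_d}` at `±i`-type signs with all
`sⱼ ≥ 2` is a combination of lower-`#4` words of the same weight.

**Mechanism (one generator).** Take `k₀ :=` `k` with parts `sⱼ − 1` and first exponent shifted by `2`
(cumulative poles multiplied by `−1`), and `l := ((1,−1),(1,1),…,(1,1))` of the same depth `d`
(word `2^d`, cumulative poles all `−1`).  In the finite double shuffle `fds(k₀, l) ∈ rel` the stuffle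
terms of minimal depth `d` are exactly ONE: the componentwise merge, which is `k`
(`filter_stuffleIdx_length_eq`, valid for any two indices of equal depth); every other stuffle term
is deeper, hence has fewer letters `4`, and is `e₁`-free because each of its cumulative poles is
(odd) + (`0` or `2`) or `0 + 2` (`e1ok_stuffle`); the shuffle terms `word k₀ ш 2^d` have `d` fewer
letters `4`.  W2b's top extraction `fds_top` (file …DepthThreeBinaryCore) then gives the statement.
(Found in the c1 lead's lab, `exp11/exp12`: interior binary words of ANY depth die by one generator,
whereas the boundary of the simplex couples to `2`-prefixed words from depth four on.)

The hypothesis "cumulative poles `±i`" is essential for this generator: a cumulative pole `−1` in the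
target would force a pole `1` in `k₀`, i.e. letters `0` in the lower terms.

Sources: J. Zhao, Doc. Math. 15 (2010), §2 Def. 2.4 (stuffle), (FDS) [Zhao2010].
-/

noncomputable section

namespace Summit.KontsevichZagierPeriods.OctahedralSymmetry.OctaSpan.RegularE0

open Literature.NumberTheory.Transcendental Literature.NumberTheory.Transcendental.LevelFour

/-! ## I. Binary INTERIOR words of every depth: one finite double shuffle each -/

/-- Componentwise merge of two indices of the same length: `((s,e),(s',e')) ↦ (s+s', e+e')`. [folklore] -/
def mergeIdx : List (ℕ × Fin 4) → List (ℕ × Fin 4) → List (ℕ × Fin 4)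
  | p :: k, q :: l => (p.1 + q.1, p.2 + q.2) :: mergeIdx k l
  | _, _ => []

/-- Every stuffle term is at least as deep as EACH factor. [cite: Zhao2010, Def. 2.4] -/
theorem length_le_of_mem_stuffleIdx : ∀ (k l : List (ℕ × Fin 4)), ∀ j ∈ stuffleIdx k l,
    k.length ≤ j.length ∧ l.length ≤ j.length
  | [], l, j, hj => by
    rw [stuffleIdx_nil_left, List.mem_singleton] at hj
    subst hj; simp
  | p :: k, [], j, hj => by
    rw [stuffleIdx_nil_right, List.mem_singleton] at hj
    subst hj; simp
  | p :: k, q :: l, j, hj => by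
    rw [stuffleIdx_cons_cons, List.mem_append, List.mem_append, List.mem_map, List.mem_map,
      List.mem_map] at hj
    rcases hj with ⟨j, hj, rfl⟩ | ⟨j, hj, rfl⟩ | ⟨j, hj, rfl⟩
    · have := length_le_of_mem_stuffleIdx k (q :: l) j hj
      simp only [List.length_cons] at this ⊢; omega
    · have := length_le_of_mem_stuffleIdx (p :: k) l j hj
      simp only [List.length_cons] at this ⊢; omega
    · have := length_le_of_mem_stuffleIdx k l j hj
      simp only [List.length_cons] at this ⊢; omega
  termination_by k l => k.length + l.length

/-- **Equal depths: the only stuffle term of minimal depth is the componentwise merge.**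
[cite: Zhao2010, Def. 2.4] -/
theorem filter_stuffleIdx_length_eq : ∀ (k l : List (ℕ × Fin 4)), k.length = l.length →
    (stuffleIdx k l).filter (fun j => j.length = k.length) = [mergeIdx k l]
  | [], [], _ => rfl
  | [], _ :: _, h => by simp at h
  | _ :: _, [], h => by simp at h
  | p :: k, q :: l, h => by
    have hkl : k.length = l.length := by simpa using h
    rw [stuffleIdx_cons_cons, List.filter_append, List.filter_append]
    have h1 : ((stuffleIdx k (q :: l)).map (List.cons p)).filter
        (fun j => j.length = (p :: k).length) = [] := by
      refine List.filter_eq_nil_iff.2 fun x hx => ?_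
      obtain ⟨j, hj, rfl⟩ := List.mem_map.1 hx
      have := (length_le_of_mem_stuffleIdx k (q :: l) j hj).2
      simp only [List.length_cons, decide_eq_true_eq] at this ⊢; omega
    have h2 : ((stuffleIdx (p :: k) l).map (List.cons q)).filter
        (fun j => j.length = (p :: k).length) = [] := by
      refine List.filter_eq_nil_iff.2 fun x hx => ?_
      obtain ⟨j, hj, rfl⟩ := List.mem_map.1 hx
      have := (length_le_of_mem_stuffleIdx (p :: k) l j hj).1
      simp only [List.length_cons, decide_eq_true_eq] at this ⊢; omega
    have h3 : ((stuffleIdx k l).map (List.cons (p.1 + q.1, p.2 + q.2))).filter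
        (fun j => j.length = (p :: k).length) =
        ((stuffleIdx k l).filter fun j => j.length = k.length).map (List.cons (p.1 + q.1, p.2 + q.2)) := by
      rw [List.filter_map]
      exact congrArg _ (List.filter_congr fun j _ => by simp)
    rw [h1, h2, h3, filter_stuffleIdx_length_eq k l hkl, List.nil_append, List.nil_append,
      List.map_singleton, mergeIdx]

/-- Boolean check: cumulative sums from `acc` all odd (poles `±i`). [folklore] -/
def psOdd : Fin 4 → List (Fin 4) → Bool
  | _, [] => true
  | a, e :: es => (decide (a + e = 1) || decide (a + e = 3)) && psOdd (a + e) es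

/-- Boolean check: cumulative sums from `b` all equal to `2` (poles `−1`). [folklore] -/
def psTwo : Fin 4 → List (Fin 4) → Bool
  | _, [] => true
  | b, f :: fs => decide (b + f = 2) && psTwo (b + f) fs

/-- Unfolding `psOdd` on a cons. [folklore] -/
theorem psOdd_cons {a e : Fin 4} {es : List (Fin 4)} :
    psOdd a (e :: es) = true ↔ (a + e = 1 ∨ a + e = 3) ∧ psOdd (a + e) es = true := by
  simp [psOdd]

/-- Unfolding `psTwo` on a cons. [folklore] -/
theorem psTwo_cons {b f : Fin 4} {fs : List (Fin 4)} :
    psTwo b (f :: fs) = true ↔ b + f = 2 ∧ psTwo (b + f) fs = true := by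
  simp [psTwo]

/-- Case table: `(odd) + (0 or 2) ≠ 0` in `Fin 4`. [folklore] -/
theorem odd_add_ne_zero {x b : Fin 4} (hx : x = 1 ∨ x = 3) (hb : b = 0 ∨ b = 2) : x + b ≠ 0 := by
  rcases hx with rfl | rfl <;> rcases hb with rfl | rfl <;> decide

/-- Case table: `(0, 1 or 3) + 2 ≠ 0` in `Fin 4`. [folklore] -/
theorem add_two_ne_zero {a y : Fin 4} (ha : a = 0 ∨ a = 1 ∨ a = 3) (hy : y = 2) : a + y ≠ 0 := by
  subst hy; rcases ha with rfl | rfl | rfl <;> decide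

/-- `e1ok` of a list whose cumulative sums from `a` are odd, read from `a + b` with `b ∈ {0, 2}`.
[folklore] -/
theorem e1ok_of_psOdd : ∀ (a b : Fin 4) (es : List (Fin 4)), (b = 0 ∨ b = 2) → psOdd a es = true →
    e1ok (a + b) es = true
  | _, _, [], _, _ => rfl
  | a, b, e :: es, hb, h => by
    obtain ⟨h1, h2⟩ := psOdd_cons.1 h
    have ih := e1ok_of_psOdd (a + e) b es hb h2
    have hne : a + b + e ≠ 0 := by rw [add_right_comm]; exact odd_add_ne_zero h1 hb
    rw [add_right_comm a e b] at ih
    simp [e1ok, ih, hne]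

/-- `e1ok` of a list whose cumulative sums from `b` are `2`, read from `a + b` with `a ∈ {0, 1, 3}`.
[folklore] -/
theorem e1ok_of_psTwo : ∀ (a b : Fin 4) (fs : List (Fin 4)), (a = 0 ∨ a = 1 ∨ a = 3) → psTwo b fs = true →
    e1ok (a + b) fs = true
  | _, _, [], _, _ => rfl
  | a, b, f :: fs, ha, h => by
    obtain ⟨h1, h2⟩ := psTwo_cons.1 h
    have ih := e1ok_of_psTwo a (b + f) fs ha h2
    have hne : a + b + f ≠ 0 := by rw [add_assoc]; exact add_two_ne_zero ha h1
    rw [← add_assoc] at ih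
    simp [e1ok, ih, hne]

/-- **Stuffles of a `±i`-coloured index with a `−1`-coloured one are `e₁`-free**: every cumulative
sum of a stuffle term is (odd) + (`0` or `2`) or `0 + 2`, never `0`. [folklore] -/
theorem e1ok_stuffle : ∀ (k l : List (ℕ × Fin 4)) (a b : Fin 4), (a = 0 ∨ a = 1 ∨ a = 3) →
    (b = 0 ∨ b = 2) → psOdd a (k.map Prod.snd) = true → psTwo b (l.map Prod.snd) = true →
    ∀ j ∈ stuffleIdx k l, e1ok (a + b) (j.map Prod.snd) = true
  | [], l, a, b, ha, _, _, hl, j, hj => by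
    rw [stuffleIdx_nil_left, List.mem_singleton] at hj
    subst hj
    exact e1ok_of_psTwo a b _ ha hl
  | p :: k, [], a, b, _, hb, hk, _, j, hj => by
    rw [stuffleIdx_nil_right, List.mem_singleton] at hj
    subst hj
    exact e1ok_of_psOdd a b _ hb hk
  | p :: k, q :: l, a, b, ha, hb, hk, hl, j, hj => by
    rw [List.map_cons] at hk hl
    obtain ⟨hk1, hk2⟩ := psOdd_cons.1 hk
    obtain ⟨hl1, hl2⟩ := psTwo_cons.1 hl
    have hodd : a + p.2 = 0 ∨ a + p.2 = 1 ∨ a + p.2 = 3 := Or.inr hk1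
    rw [stuffleIdx_cons_cons, List.mem_append, List.mem_append, List.mem_map, List.mem_map,
      List.mem_map] at hj
    rcases hj with ⟨j, hj, rfl⟩ | ⟨j, hj, rfl⟩ | ⟨j, hj, rfl⟩
    · have ih := e1ok_stuffle k (q :: l) (a + p.2) b hodd hb hk2
        (by rw [List.map_cons]; exact psTwo_cons.2 ⟨hl1, hl2⟩) j hj
      have hne : a + b + p.2 ≠ 0 := by rw [add_right_comm]; exact odd_add_ne_zero hk1 hb
      rw [add_right_comm a p.2 b] at ih
      simp [e1ok, ih, hne]
    · have ih := e1ok_stuffle (p :: k) l a (b + q.2) ha (Or.inr hl1)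
        (by rw [List.map_cons]; exact psOdd_cons.2 ⟨hk1, hk2⟩) hl2 j hj
      have hne : a + b + q.2 ≠ 0 := by rw [add_assoc]; exact add_two_ne_zero ha hl1
      rw [← add_assoc] at ih
      simp [e1ok, ih, hne]
    · have ih := e1ok_stuffle k l (a + p.2) (b + q.2) hodd (Or.inr hl1) hk2 hl2 j hj
      have hne : a + b + (p.2 + q.2) ≠ 0 := by
        rw [show a + b + (p.2 + q.2) = (a + p.2) + (b + q.2) from by abel]
        exact odd_add_ne_zero hk1 (Or.inr hl1)
      rw [show a + p.2 + (b + q.2) = a + b + (p.2 + q.2) from by abel] at ih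
      simp [e1ok, ih, hne]
  termination_by k l => k.length + l.length

/-- Shifting the start by `2` keeps cumulative sums odd. [folklore] -/
theorem psOdd_add_two : ∀ (a : Fin 4) (es : List (Fin 4)), psOdd a es = true → psOdd (a + 2) es = true
  | _, [], _ => rfl
  | a, e :: es, h => by
    obtain ⟨h1, h2⟩ := psOdd_cons.1 h
    refine psOdd_cons.2 ⟨?_, by rw [add_right_comm]; exact psOdd_add_two (a + e) es h2⟩
    rw [add_right_comm]
    rcases h1 with h | h <;> (rw [h]; decide)

/-- The exponent list `(0, …, 0)` keeps the cumulative sum at `2`. [folklore] -/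
theorem psTwo_zeros : ∀ n : ℕ, psTwo 2 ((List.replicate n ((1 : ℕ), (0 : Fin 4))).map Prod.snd) = true
  | 0 => rfl
  | n + 1 => psTwo_cons.2 ⟨by decide, by rw [add_zero]; exact psTwo_zeros n⟩

/-- Lowering every part by one: `(s, e) ↦ (s - 1, e)`. [folklore] -/
def lowerParts (t : List (ℕ × Fin 4)) : List (ℕ × Fin 4) := t.map fun p => (p.1 - 1, p.2)

/-- `mergeIdx (lowerParts t) ((1,0), …, (1,0)) = t` when all parts are `≥ 1`. [folklore] -/
theorem mergeIdx_lowerParts : ∀ (t : List (ℕ × Fin 4)), (∀ p ∈ t, 1 ≤ p.1) →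
    mergeIdx (lowerParts t) (List.replicate t.length ((1 : ℕ), (0 : Fin 4))) = t
  | [], _ => rfl
  | p :: t, h => by
    have hp : 1 ≤ p.1 := h p (by simp)
    have ih := mergeIdx_lowerParts t fun q hq => h q (by simp [hq])
    simp only [lowerParts, List.map_cons] at ih ⊢
    rw [List.length_cons, List.replicate_succ, mergeIdx, ih, add_zero, Nat.sub_add_cancel hp]

/-- Weight of `lowerParts`: `wt (lowerParts t) + |t| = wt t` when all parts are `≥ 1`. [folklore] -/
theorem wt_lowerParts : ∀ (t : List (ℕ × Fin 4)), (∀ p ∈ t, 1 ≤ p.1) → wt (lowerParts t) + t.length = wt t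
  | [], _ => rfl
  | p :: t, h => by
    have hp : 1 ≤ p.1 := h p (by simp)
    have ih := wt_lowerParts t fun q hq => h q (by simp [hq])
    simp only [wt, lowerParts, List.map_cons, List.map_map, List.sum_cons, List.length_cons] at ih ⊢
    simp only [Function.comp_def] at ih ⊢
    omega

/-- Weight of the all-ones index: `wt ((1,0),…,(1,0)) = n`. [folklore] -/
theorem wt_ones (n : ℕ) : wt (List.replicate n ((1 : ℕ), (0 : Fin 4))) = n := by
  induction n with
  | zero => rfl
  | succ n ih => simp only [wt, List.replicate_succ, List.map_cons, List.sum_cons] at ih ⊢; omega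

/-- **Binary INTERIOR words of every depth (all weights).** An `e₁`-free word over the poles
`{0, i, −i}` all of whose blocks of letters `4` are NONEMPTY — the word of an index `k` with all parts
`sⱼ ≥ 2` and all cumulative poles `±i`, i.e. the value `Li_{s₁,…,s_d}` at `±i`-type signs with every
`sⱼ ≥ 2` — lies, modulo `rel`, in the span of the `e₁`-free convergent words of its length with fewer
letters `4`: ONE finite double shuffle does it, that of `k₀` (parts `sⱼ − 1`, first exponent shifted by
`2`) with `l = ((1,−1),(1,1),…,(1,1))` (word `2^d`), whose unique depth-`d` stuffle term (the componentwise
merge, `filter_stuffleIdx_length_eq`) is `k` itself and whose other terms are `e₁`-free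
(`e1ok_stuffle`) with fewer letters `4`. [cite: Zhao2010, §2 (FDS)] -/
theorem binaryInterior (k : List (ℕ × Fin 4)) (hk : k ≠ []) (hs : ∀ p ∈ k, 2 ≤ p.1)
    (hodd : psOdd 0 (k.map Prod.snd) = true) : sym (word k) ∈ rel ⊔ e0Lower (word k) := by
  obtain ⟨p₀, t, rfl⟩ := List.exists_cons_of_ne_nil hk
  -- the two indices
  set k₀ : List (ℕ × Fin 4) := (p₀.1 - 1, p₀.2 + 2) :: lowerParts t with hk₀
  set l : List (ℕ × Fin 4) := (1, 2) :: List.replicate t.length ((1 : ℕ), (0 : Fin 4)) with hl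
  have hp₀ : 2 ≤ p₀.1 := hs p₀ (by simp)
  have ht1 : ∀ p ∈ t, 1 ≤ p.1 := fun p hp => le_trans (by decide) (hs p (by simp [hp]))
  have hkpos : ∀ p ∈ p₀ :: t, 1 ≤ p.1 := fun p hp => le_trans (by decide) (hs p hp)
  rw [List.map_cons] at hodd
  obtain ⟨he₀, hoddt⟩ := psOdd_cons.1 hodd
  rw [zero_add] at he₀ hoddt
  have hk₀pos : ∀ p ∈ k₀, 1 ≤ p.1 := by
    intro p hp
    rcases List.mem_cons.1 hp with rfl | hp
    · dsimp only; omega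
    · obtain ⟨q, hq, rfl⟩ := List.mem_map.1 hp
      have := hs q (by simp [hq]); dsimp only; omega
  have hk₀conv : IsConvergentIdx k₀ :=
    isConvergentIdx_cons (by omega) (fun _ h0 => by rcases he₀ with h | h <;> rw [h] at h0 <;> exact absurd h0 (by decide))
      fun p hp => hk₀pos p (List.mem_cons_of_mem _ hp)
  have hlpos : ∀ p ∈ l, 1 ≤ p.1 := by
    intro p hp
    rcases List.mem_cons.1 hp with rfl | hp
    · exact le_rfl
    · rw [(List.eq_of_mem_replicate hp : p = (1, 0))]
  have hlconv : IsConvergentIdx l := isConvergentIdx_cons le_rfl (fun _ => by decide) fun p hp => hlpos p (List.mem_cons_of_mem _ hp)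
  have hlen : k₀.length = l.length := by simp [hk₀, hl, lowerParts]
  have hmerge : mergeIdx k₀ l = p₀ :: t := by
    rw [hk₀, hl, mergeIdx, mergeIdx_lowerParts t ht1, Nat.sub_add_cancel (le_trans (by decide) hp₀),
      add_assoc, show (2 : Fin 4) + 2 = 0 from by decide, add_zero]
  have hoddk₀ : psOdd 0 (k₀.map Prod.snd) = true := by
    rw [hk₀, List.map_cons]
    refine psOdd_cons.2 ⟨?_, ?_⟩
    · show (0 : Fin 4) + (p₀.2 + 2) = 1 ∨ (0 : Fin 4) + (p₀.2 + 2) = 3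
      rw [zero_add]; rcases he₀ with h | h <;> (rw [h]; decide)
    · show psOdd ((0 : Fin 4) + (p₀.2 + 2)) ((lowerParts t).map Prod.snd) = true
      rw [zero_add]
      have : (lowerParts t).map Prod.snd = t.map Prod.snd := by simp [lowerParts, List.map_map, Function.comp_def]
      rw [this]
      exact psOdd_add_two _ _ hoddt
  have htwol : psTwo 0 (l.map Prod.snd) = true := by
    rw [hl, List.map_cons]
    exact psTwo_cons.2 ⟨by decide, by rw [zero_add]; exact psTwo_zeros t.length⟩
  -- weights and counts
  have hwt : wt k₀ + wt l = wt (p₀ :: t) := by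
    have h1 := wt_lowerParts t ht1
    have h2 := wt_ones t.length
    have e1 : wt k₀ = (p₀.1 - 1) + wt (lowerParts t) := by simp [hk₀, wt]
    have e2 : wt l = 1 + wt (List.replicate t.length ((1 : ℕ), (0 : Fin 4))) := by simp [hl, wt]
    have e3 : wt (p₀ :: t) = p₀.1 + wt t := by simp [wt]
    omega
  have h4k : (word (p₀ :: t)).count 4 + (p₀ :: t).length = wt (p₀ :: t) := count_four_wordAux 0 _ hkpos
  have h4k₀ : (word k₀).count 4 + k₀.length = wt k₀ := count_four_wordAux 0 _ hk₀pos
  have h4l : (word l).count 4 + l.length = wt l := count_four_wordAux 0 _ hlpos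
  have hk₀len : k₀.length = (p₀ :: t).length := by simp [hk₀, lowerParts]
  have h0k₀ : (word k₀).count 0 = 0 :=
    count_zero_wordAux 0 k₀ (by simpa using e1ok_of_psOdd 0 0 _ (Or.inl rfl) hoddk₀)
  have h0l : (word l).count 0 = 0 :=
    count_zero_wordAux 0 l (by simpa using e1ok_of_psTwo 0 0 _ (Or.inl rfl) htwol)
  -- the one generator
  have htop := fds_top hk₀conv hlconv (e0Lower (word (p₀ :: t))) ?_ ?_
  · rw [filter_stuffleIdx_length_eq k₀ l hlen, hmerge, List.map_singleton, List.sum_singleton] at htop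
    exact htop
  · -- the deeper stuffle terms are lower
    intro j hj hjl
    obtain ⟨hjwt, hjlen, hjpos⟩ := stuffle_wt k₀ l j hj
    have hjpos := hjpos hk₀pos hlpos
    have h4j : (word j).count 4 + j.length = wt j := count_four_wordAux 0 j hjpos
    have h0j : (word j).count 0 = 0 :=
      count_zero_wordAux 0 j (by simpa using e1ok_stuffle k₀ l 0 0 (Or.inl rfl) (Or.inl rfl) hoddk₀ htwol j hj)
    have hjne : j ≠ [] := by
      rintro rfl
      simp only [List.length_nil, Nat.le_zero, List.length_eq_zero_iff] at hjlen
      exact hjl (by rw [hjlen])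
    refine sym_mem_e0Lower ?_ (isConvergent_word_of_count_zero hjne h0j) h0j ?_
    · rw [length_word j hjpos, length_word _ hkpos]; change wt j = wt (p₀ :: t); omega
    · have : (p₀ :: t).length < j.length := by rw [← hk₀len]; omega
      omega
  · -- the shuffle terms are lower
    refine toQ_shuffle_mem _ _ _ fun w hw => ?_
    have hperm := MZV.perm_of_mem_shuffleWord _ _ hw
    refine sym_mem_e0Lower ?_ ?_ ?_ ?_
    · rw [hperm.length_eq, List.length_append, length_word k₀ hk₀pos, length_word l hlpos,
        length_word _ hkpos]; change wt k₀ + wt l = wt (p₀ :: t); exact hwt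
    · exact isConvergent_of_mem_shuffleWord (isConvergent_word hk₀conv) (isConvergent_word hlconv) hw
    · rw [hperm.count_eq, List.count_append, h0k₀, h0l]
    · rw [hperm.count_eq, List.count_append]
      have hl1 : 1 ≤ l.length := by simp [hl]
      omega

end Summit.KontsevichZagierPeriods.OctahedralSymmetry.OctaSpan.RegularE0

end
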